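import Summits.CriticalPhenomena.PercolationContinuityZ3.Theorems.Transplant.FKDoubleFanMultifanCone
import HarnessLib

/-!
# Double fans `K₂ ∨ P_{m+1}`: the sign orthant of the MULTIFAN₁ images — certificates G (`uv + xy ≥ 0` (131 terms): the free coordinate `xy` is dominated by `uv`)

Helper file (`--supports stmt-CriticalPhenomena-4575`), FK sub-lane `prim-bschramm-fk-3` (gen 44); builds on p205010 (kernel theorem, internal
audit signed; external expert review pending).  No named facts, no sorries; standard axioms.  Memo `bschramm/prim-bschramm-fk-3/FAR-CROSS-XIX.md` §2g.

Continuation of `…MultifanSignsCertA–E` (the nine coordinate signs).  The tenth hat–Plücker coordinate `xy` of a MULTIFAN₁ image `imgAB q F G u` has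
no fixed sign, but `|xy| ≤ uv` (and `≤ zv`) on `Valid³`, `0 ≤ q ≤ 1` (exact census of the memo); this file proves **`imgAB_uv_add_xy_nonneg`** as an explicit q-parametric
product-form identity (kit j295605, exact rational verification).  With certificates A–G the sup norm of a MULTIFAN₁ image is dominated by the signed
coordinate sum — the positivity functional of `hypAC_of_crossPosA` (`…MultifanSigns`).  `maxHeartbeats`/`maxRecDepth` raised for `ring`.
[folklore]
-/

noncomputable section

namespace Summit.CriticalPhenomena.PercolationContinuityZ3.Theorems

namespace FK

namespace ThreeApex

set_option maxHeartbeats 4000000 in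
set_option maxRecDepth 8000 in
/-- `(imgAB)_uv + (imgAB)_xy ≥ 0` (so `|xy| ≤ uv`) for the MULTIFAN₁ image: the certificate identity (131 terms, non-negative combination of `q`-factors and valid forms of the
three legs; product-form LP, kit j294716, exact rational verification). [folklore] -/
theorem imgAB_uv_add_xy_nonneg_eq (q : ℝ) (F G u : V5) :
    (imgAB q F G u).uv + (imgAB q F G u).xy =
      (1 : ℝ) * (F.z0 * F.zab) * (G.zab * G.z1) * masterN q (swapAB u)
      + (1 : ℝ) * (F.z0 * F.zab) * (G.zac * G.z1) * masterN q (swapAB u)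
      + (1 : ℝ) * (F.z0 * F.zbc) * (G.zac * G.zbc) * masterN q (swapAB u)
      + (1 : ℝ) * (F.zab * F.zbc) * (G.zab * G.z1) * masterN q (swapAB u)
      + (1 : ℝ) * (F.zab * F.zbc) * (G.zac * G.z1) * masterN q (swapAB u)
      + (1 : ℝ) / 4 * (F.zac * F.zac) * masterN q G * kap (swapAB u)
      + (1 : ℝ) / 4 * (F.zac * F.z1) * masterN q G * kap (swapAB u)
      + (1 : ℝ) * masterN q F * (G.z0 * G.zbc) * masterN q (swapAB u)
      + (1 : ℝ) * masterN q F * (G.zab * G.zac) * (u.z0 * u.z0)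
      + (1 : ℝ) * masterN q F * (G.zab * G.zac) * (u.z0 * u.zac)
      + (1 : ℝ) * masterN q F * (G.zab * G.zac) * masterN q (swapAB u)
      + (1 : ℝ) * masterN q F * (G.zab * G.z1) * (u.z0 * u.z0)
      + (1 : ℝ) * masterN q F * (G.zab * G.z1) * (u.z0 * u.zab)
      + (1 : ℝ) * masterN q F * (G.zac * G.zac) * (u.z0 * u.z0)
      + (1 : ℝ) * masterN q F * (G.zac * G.zac) * (u.z0 * u.zab)
      + (1 : ℝ) * masterN q F * (G.zac * G.zac) * (u.z0 * u.zac)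
      + (1 : ℝ) * masterN q F * (G.zac * G.zac) * (u.zab * u.zac)
      + (1 : ℝ) * masterN q F * masterN q G * (u.z0 * u.zab)
      + (1 : ℝ) / 4 * masterN q F * masterN q G * (u.z0 * u.zac)
      + (3 : ℝ) / 4 * masterN q F * masterN q G * (u.z0 * u.zbc)
      + (1 : ℝ) / 4 * masterN q F * masterN q G * (u.zab * u.zac)
      + (3 : ℝ) / 4 * masterN q F * masterN q G * (u.zab * u.zbc)
      + (1 : ℝ) * masterN q (swapAB F) * kap (swapAB G) * masterN q (swapAB u)
      + (1 : ℝ) * kap F * masterN q G * masterN q (swapAB u)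
      + (1 : ℝ) / 2 * (2 - q) * (F.z0 * F.z0) * (G.zab * G.z1) * masterN q (swapAB u)
      + (1 : ℝ) / 2 * (2 - q) * (F.z0 * F.z0) * (G.zac * G.z1) * masterN q (swapAB u)
      + (1 : ℝ) / 4 * (2 - q) * (F.z0 * F.zac) * (G.zac * G.zac) * kap (swapAB u)
      + (1 : ℝ) / 2 * (2 - q) * (F.z0 * F.zbc) * (G.zab * G.z1) * masterN q (swapAB u)
      + (1 : ℝ) / 2 * (2 - q) * (F.z0 * F.zbc) * (G.zac * G.z1) * masterN q (swapAB u)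
      + (1 : ℝ) / 4 * (2 - q) * (F.zab * F.zac) * (G.zac * G.zac) * kap (swapAB u)
      + (1 : ℝ) / 4 * (2 - q) * (F.zab * F.zac) * (G.zac * G.z1) * kap (swapAB u)
      + (1 : ℝ) / 2 * (2 - q) * (F.zab * F.zbc) * (G.zac * G.zbc) * masterN q (swapAB u)
      + (1 : ℝ) / 2 * (2 - q) * (F.zac * F.zac) * (G.z0 * G.zac) * masterN q (swapAB u)
      + (3 : ℝ) / 4 * (2 - q) * (F.zac * F.zac) * (G.zab * G.zac) * kap (swapAB u)
      + (3 : ℝ) / 4 * (2 - q) * (F.zac * F.zbc) * (G.zab * G.zac) * kap (swapAB u)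
      + (1 : ℝ) / 4 * (2 - q) * (F.zac * F.zbc) * masterN q G * kap (swapAB u)
      + (1 : ℝ) / 2 * (2 - q) * (F.zac * F.z1) * (G.z0 * G.zac) * masterN q (swapAB u)
      + (3 : ℝ) / 4 * (2 - q) * (F.zac * F.z1) * (G.zab * G.zac) * kap (swapAB u)
      + (1 : ℝ) / 2 * (2 - q) * masterN q F * (G.z0 * G.z1) * masterN q (swapAB u)
      + (1 : ℝ) / 4 * (2 - q) * masterN q F * (G.zab * G.zac) * (u.z0 * u.zab)
      + (1 : ℝ) / 4 * (2 - q) * masterN q F * (G.zab * G.zac) * (u.z0 * u.zbc)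
      + (1 : ℝ) / 4 * (2 - q) * masterN q F * (G.zab * G.zac) * (u.zab * u.zac)
      + (1 : ℝ) / 4 * (2 - q) * masterN q F * (G.zab * G.zac) * (u.zac * u.zbc)
      + (1 : ℝ) / 4 * (2 - q) * masterN q F * (G.zab * G.zac) * kap (swapBC u)
      + (1 : ℝ) / 2 * (2 - q) * masterN q F * (G.zab * G.zbc) * masterN q (swapAB u)
      + (1 : ℝ) / 2 * (2 - q) * masterN q F * (G.zab * G.z1) * (u.z0 * u.zac)
      + (1 : ℝ) / 2 * (2 - q) * masterN q F * (G.zab * G.z1) * (u.zab * u.zac)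
      + (1 : ℝ) / 2 * (2 - q) * masterN q F * (G.zab * G.z1) * masterN q (swapAB u)
      + (1 : ℝ) * (2 - q) * masterN q F * (G.zab * G.z1) * kap (swapAB u)
      + (1 : ℝ) / 2 * (2 - q) * masterN q F * masterN q G * (u.z0 * u.z0)
      + (3 : ℝ) / 8 * (2 - q) * masterN q F * masterN q G * kap u
      + (1 : ℝ) * (2 - q) * kap F * (G.zab * G.z1) * masterN q (swapAB u)
      + (1 : ℝ) / 2 * (2 - q) * kap (swapAB F) * (G.z0 * G.z1) * masterN q (swapAB u)
      + (1 : ℝ) / 2 * (2 - q) * kap (swapAB F) * (G.zab * G.zbc) * masterN q (swapAB u)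
      + (1 : ℝ) / 8 * (2 - q) ^ 2 * (F.z0 * F.zac) * (G.zac * G.z1) * kap (swapAB u)
      + (1 : ℝ) / 4 * (2 - q) ^ 2 * (F.zac * F.zbc) * (G.z0 * G.zac) * masterN q (swapAB u)
      + (1 : ℝ) / 2 * (2 - q) ^ 2 * (F.zac * F.zbc) * (G.z0 * G.zbc) * masterN q (swapAB u)
      + (1 : ℝ) / 2 * (2 - q) ^ 2 * masterN q F * (G.zab * G.zbc) * kap (swapAB u)
      + (1 : ℝ) / 2 * (2 - q) ^ 2 * lam F * (G.z0 * G.zbc) * masterN q (swapAB u)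
      + (1 : ℝ) / 2 * (2 - q) ^ 2 * kap F * (G.z0 * G.z1) * masterN q (swapAB u)
      + (1 : ℝ) * q * (F.z0 * F.z0) * (G.z0 * G.z1) * masterN q (swapAB u)
      + (1 : ℝ) * q * (F.z0 * F.z0) * (G.zab * G.zbc) * masterN q (swapAB u)
      + (1 : ℝ) / 2 * q * (F.z0 * F.z0) * (G.zab * G.z1) * masterN q (swapAB u)
      + (1 : ℝ) * q * (F.z0 * F.z0) * (G.zac * G.zbc) * masterN q (swapAB u)
      + (1 : ℝ) / 2 * q * (F.z0 * F.z0) * (G.zac * G.z1) * masterN q (swapAB u)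
      + (1 : ℝ) * q * (F.z0 * F.zab) * (G.zab * G.zbc) * masterN q (swapAB u)
      + (1 : ℝ) * q * (F.z0 * F.zab) * (G.zac * G.zbc) * masterN q (swapAB u)
      + (1 : ℝ) * q * (F.z0 * F.zac) * kap (swapAB G) * masterN q (swapAB u)
      + (1 : ℝ) / 2 * q * (F.z0 * F.zbc) * (G.z0 * G.z1) * masterN q (swapAB u)
      + (1 : ℝ) / 2 * q * (F.z0 * F.zbc) * (G.zab * G.zbc) * masterN q (swapAB u)
      + (1 : ℝ) / 2 * q * (F.z0 * F.zbc) * (G.zab * G.z1) * masterN q (swapAB u)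
      + (1 : ℝ) / 2 * q * (F.z0 * F.zbc) * (G.zac * G.z1) * masterN q (swapAB u)
      + (1 : ℝ) * q * (F.zab * F.zac) * kap (swapAB G) * masterN q (swapAB u)
      + (1 : ℝ) / 2 * q * (F.zab * F.zbc) * (G.z0 * G.z1) * masterN q (swapAB u)
      + (1 : ℝ) * q * (F.zab * F.zbc) * (G.zab * G.zac) * masterN q (swapAB u)
      + (1 : ℝ) / 2 * q * (F.zab * F.zbc) * (G.zab * G.zbc) * masterN q (swapAB u)
      + (1 : ℝ) / 2 * q * (F.zab * F.zbc) * (G.zac * G.zbc) * masterN q (swapAB u)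
      + (1 : ℝ) / 2 * q * (F.zac * F.zac) * kap G * masterN q (swapAB u)
      + (1 : ℝ) / 2 * q * (F.zac * F.zbc) * kap G * masterN q (swapAB u)
      + (1 : ℝ) / 2 * q * (F.zac * F.z1) * kap G * masterN q (swapAB u)
      + (1 : ℝ) * q * masterN q F * (G.z0 * G.zac) * (u.z0 * u.z0)
      + (1 : ℝ) * q * masterN q F * (G.z0 * G.zac) * (u.z0 * u.zab)
      + (1 : ℝ) * q * masterN q F * (G.z0 * G.zac) * (u.z0 * u.zac)
      + (1 : ℝ) * q * masterN q F * (G.z0 * G.zac) * (u.zab * u.zac)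
      + (1 : ℝ) / 2 * q * masterN q F * (G.zab * G.zac) * (u.z0 * u.zab)
      + (1 : ℝ) / 2 * q * masterN q F * (G.zab * G.zac) * (u.zab * u.zac)
      + (1 : ℝ) * q * masterN q F * (G.zab * G.zbc) * (u.z0 * u.zab)
      + (1 : ℝ) * q * masterN q F * (G.zab * G.zbc) * (u.z0 * u.zac)
      + (1 : ℝ) * q * masterN q F * (G.zab * G.zbc) * (u.zab * u.zac)
      + (1 : ℝ) * q * masterN q F * (G.zab * G.zbc) * masterN q (swapAB u)
      + (1 : ℝ) / 2 * q * masterN q F * (G.zab * G.z1) * (u.z0 * u.zac)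
      + (1 : ℝ) / 2 * q * masterN q F * (G.zab * G.z1) * (u.zab * u.zac)
      + (1 : ℝ) / 2 * q * masterN q F * (G.zab * G.z1) * masterN q (swapAB u)
      + (1 : ℝ) / 2 * q * masterN q F * masterN q G * (u.z0 * u.z0)
      + (3 : ℝ) / 8 * q * masterN q F * masterN q G * kap u
      + (1 : ℝ) / 2 * q * (2 - q) * (F.z0 * F.zab) * (G.z0 * G.z1) * masterN q (swapAB u)
      + (1 : ℝ) / 8 * q * (2 - q) * (F.z0 * F.zac) * (G.zac * G.z1) * kap (swapAB u)
      + (1 : ℝ) / 2 * q * (2 - q) * (F.z0 * F.zbc) * (G.zab * G.zac) * masterN q (swapAB u)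
      + (1 : ℝ) / 4 * q * (2 - q) * (F.zac * F.zbc) * (G.z0 * G.zac) * masterN q (swapAB u)
      + (1 : ℝ) / 2 * q * (2 - q) * masterN q F * (G.zab * G.zbc) * (u.z0 * u.z0)
      + (1 : ℝ) / 2 * q * (2 - q) * masterN q F * (G.zab * G.zbc) * kap (swapAB u)
      + (1 : ℝ) / 2 * q * (2 - q) * kap F * (G.zab * G.zbc) * masterN q (swapAB u)
      + (1 : ℝ) / 2 * q * (2 - q) * kap (swapAB F) * (G.z0 * G.zbc) * masterN q (swapAB u)
      + (1 : ℝ) * q ^ 2 * (F.z0 * F.z0) * (G.z0 * G.zbc) * masterN q (swapAB u)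
      + (1 : ℝ) / 2 * q ^ 2 * (F.z0 * F.zab) * (G.z0 * G.zbc) * masterN q (swapAB u)
      + (1 : ℝ) / 2 * q ^ 2 * (F.z0 * F.zab) * (G.zab * G.zac) * masterN q (swapAB u)
      + (1 : ℝ) / 2 * q ^ 2 * (F.z0 * F.zab) * kap (swapAB G) * masterN q (swapAB u)
      + (1 : ℝ) / 4 * q ^ 2 * (F.z0 * F.zac) * (G.z0 * G.zac) * kap (swapAB u)
      + (1 : ℝ) / 4 * q ^ 2 * (F.z0 * F.zac) * (G.zac * G.zbc) * kap (swapAB u)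
      + (1 : ℝ) / 2 * q ^ 2 * (F.z0 * F.zbc) * (G.z0 * G.zbc) * masterN q (swapAB u)
      + (1 : ℝ) / 2 * q ^ 2 * (F.z0 * F.zbc) * (G.zab * G.zac) * masterN q (swapAB u)
      + (1 : ℝ) / 4 * q ^ 2 * (F.zab * F.zac) * (G.z0 * G.zac) * kap (swapAB u)
      + (1 : ℝ) / 4 * q ^ 2 * (F.zab * F.zac) * (G.zac * G.zbc) * kap (swapAB u)
      + (1 : ℝ) / 2 * q ^ 2 * (F.zab * F.zbc) * (G.z0 * G.zbc) * masterN q (swapAB u)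
      + (1 : ℝ) / 2 * q ^ 2 * masterN q F * (G.zab * G.zbc) * (u.z0 * u.z0)
      + (1 : ℝ) / 2 * (1 - q) * (F.zac * F.zac) * kap G * kap (swapAB u)
      + (1 : ℝ) / 2 * (1 - q) * (F.zac * F.z1) * kap G * kap (swapAB u)
      + (1 : ℝ) / 4 * (1 - q) * lam F * masterN q G * kap (swapAB u)
      + (1 : ℝ) / 2 * (1 - q) * kap F * masterN q G * kap (swapAB u)
      + (1 : ℝ) / 4 * (1 - q) * (2 - q) * (F.z0 * F.zac) * (G.zab * G.zac) * kap (swapAB u)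
      + (1 : ℝ) / 4 * (1 - q) * (2 - q) * (F.z0 * F.zac) * lam G * kap (swapAB u)
      + (1 : ℝ) / 4 * (1 - q) * (2 - q) * (F.zab * F.zac) * (G.zab * G.zac) * kap (swapAB u)
      + (1 : ℝ) / 4 * (1 - q) * (2 - q) * (F.zab * F.zac) * lam G * kap (swapAB u)
      + (1 : ℝ) * (1 - q) * (2 - q) * (F.zac * F.zbc) * (G.zab * G.zbc) * kap (swapAB u)
      + (1 : ℝ) / 2 * (1 - q) * (2 - q) * (F.zac * F.zbc) * kap G * kap (swapAB u)
      + (1 : ℝ) / 4 * (1 - q) * (2 - q) * masterN q F * kap G * kap (swapAB u)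
      + (1 : ℝ) * (1 - q) * (2 - q) * lam F * (G.zab * G.zbc) * kap (swapAB u)
      + (1 : ℝ) / 4 * (1 - q) * (2 - q) * kap F * (G.zab * G.zac) * kap (swapAB u)
      + (1 : ℝ) * (1 - q) * (2 - q) * kap F * (G.zab * G.z1) * kap (swapAB u)
      + (1 : ℝ) / 4 * (1 - q) * q * masterN q F * kap G * kap (swapAB u)
      + (1 : ℝ) / 2 * (1 - q) ^ 2 * lam F * kap G * kap (swapAB u) := by
  simp only [imgAB, wedgeH, fanComboB, fanCombo, conv, edgeAC, edgeBC, detach, V5.total, hx, hy, hz, masterN, kap, lam, swapAB, swapBC]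
  ring

set_option maxHeartbeats 4000000 in
set_option maxRecDepth 8000 in
/-- `(imgAB)_uv + (imgAB)_xy ≥ 0` (so `|xy| ≤ uv`) for every MULTIFAN₁ image over `Valid³` (`0 ≤ q ≤ 1`). [folklore] -/
theorem imgAB_uv_add_xy_nonneg {q : ℝ} {F G u : V5} (hq0 : 0 ≤ q) (hq1 : q ≤ 1) (hF : Valid q F) (hG : Valid q G) (hu : Valid q u) :
    0 ≤ (imgAB q F G u).uv + (imgAB q F G u).xy := by
  obtain ⟨⟨hF0, hFab, hFac, hFbc, hF1⟩, hFN, hFNab, hFNbc, hFL, hFk, hFkb, hFkc⟩ := hF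
  obtain ⟨⟨hG0, hGab, hGac, hGbc, hG1⟩, hGN, hGNab, hGNbc, hGL, hGk, hGkb, hGkc⟩ := hG
  obtain ⟨⟨hu0, huab, huac, hubc, hu1⟩, huN, huNab, huNbc, huL, huk, hukb, hukc⟩ := hu
  have hp : 0 ≤ 1 - q := by linarith
  have hr : 0 ≤ 2 - q := by linarith
  rw [imgAB_uv_add_xy_nonneg_eq]
  positivity

end ThreeApex

end FK

end Summit.CriticalPhenomena.PercolationContinuityZ3.Theorems
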